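import Literature.NumberTheory.ConnesConsani2021.JumpFormula
import Literature.Analysis.OperatorTheory.HermitianKernelOperator
import HarnessLib

/-!
# Connes–Consani 2021, Prop. 5.5 (ii) / Thm. 3.6: the operator `𝐊_I` of (opkf) is an integral
# operator on `L²(I)` with bounded kernel `ϖ(y − x)`, hence COMPACT — PROVED

A. Connes, C. Consani, *Weil positivity and trace formula, the archimedean place*, Selecta Math.
(N.S.) 27 (2021), Paper No. 77 = arXiv:2006.13771 [bib: `ConnesConsani2021`].  Theorem 3.6
(= Thm. 17 of the arXiv text, p. 13): "There exists a compact operator `K_I` in the Hilbert space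
`L²(√I, d*ρ)` such that … `D∘Q(ξ ∗ ξ*) = ⟨ξ|(−2 + K_I)ξ⟩`", proof (p. 13): "To prove that `K_I` is a
compact operator we first show that it is given by a Schwartz kernel `K̃_I(v, u)` …
`K̃_I(v,u) = Qδ(u/v)` if `u ≥ v`, `Qδ(v/u)` if `v ≥ u`.  Since the interval `√I` is bounded, the
function `K̃_I(v,u)` is square integrable and hence the operator `K_I` is of Hilbert–Schmidt class and
hence compact."  Proposition 5.5 (= Prop. 32, p. 20): "(ii) One has `N_I = −2ε′(1₊)(1 − 𝐊_I)`, where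
`𝐊_I` is the compact operator defined by (opkf)
`⟨ξ|𝐊_I(ξ)⟩ = (2ε′(1₊))⁻¹ ∫_{−log 2}^{log 2} ∫ ξ(x) ξ̄(x+v) (Qε)(exp|v|) dx dv`", proof (p. 21):
"The proof of the compactness of the operator `𝐊_I` is the same as the argument developed at the end
of the proof of Theorem 3.6.  This shows that `𝐊_I` is of Hilbert–Schmidt class."

**What is PROVED here**, for the tree's operator `windowOp a b κ` of (opkf)
(`KernelApproximation.lean`: the bounded operator on `𝓗 = L²([a, b], dx)` with
`⟨η | windowOp κ ξ⟩ = ∫_{a−b}^{b−a} ∫ ξ(x) η̄(x+v) κ(v) dx dv`):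

* `inner_windowOp_eq_integral_integral` — **the Schwartz kernel**: for `κ` continuous,
  `⟨η | windowOp κ ξ⟩ = ∫_I η̄(y) ∫_I κ_S(y − x) ξ(x) dx dy`, where `κ_S = 1_{[a−b, b−a]} κ` (on
  `I × I` one has `y − x ∈ [a − b, b − a]`, so `κ_S(y − x) = κ(y − x)`): `windowOp κ` is the integral
  operator on `L²(I)` with kernel `K(y, x) = κ(y − x)` (CC's `K̃_I(v, u) = Qδ(u/v)` / `Qδ(v/u)`, i.e.
  the even function `(Qδ)(exp|y − x|)` in the additive variable) — one Fubini on `ℝ × ℝ` (shear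
  `(v, x) ↦ (x, x + v)`) and one on `I × I`;
* `windowOp_eq_of_ae_kernel` — hence `windowOp κ` coincides with any bounded operator `A` given a.e.
  by the kernel formula `(Aξ)(y) = ∫_I κ_S(y − x) ξ(x) dx` (the tree's
  `Literature.Analysis.OperatorTheory.exists_kernelOp_rclike`);
* `isCompactOperator_windowOp` — **compactness**: "since the interval is bounded, the [kernel] is
  square integrable and hence the operator is of Hilbert–Schmidt class and hence compact" — here via
  the tree's `isCompactOperator_of_ae_kernel` (a bounded measurable kernel on a finite measure space
  gives a compact operator; sup-norm criterion, equivalently Hilbert–Schmidt), the kernel being bounded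
  by `sup_{[a−b,b−a]} |κ|`;
* `isCompactOperator_windowOp_varpi` — in particular CC's `𝐊_I = windowOp ϖ_G` of Prop. 5.5 (ii)
  (`JumpFormula.lean`: `ϖ_G = (opQ G)(|·|)/(2G′(0))`, continuous for `G ∈ C²`) is compact, and so is
  the operator `windowOp ((opQ G)∘|·|)` of Theorem 3.6's shape; with
  `JumpFormula.evenFunctional_opQ_autocorr_eq_inner_opN` this completes the typed statement of
  Prop. 5.5 (i)+(ii) generically in the even function (what is specific to CC — `G = ε∘exp`, its
  regularity and `ε′(1₊)` — is not typed).

No RH claim; no named fact is introduced (cell `pub-rhdoor`, `HOME/lit/CC2021-RIGOUR-MAP.md` §1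
items 3, 6).
-/

noncomputable section

open MeasureTheory Set Complex Filter Function
open scoped ComplexConjugate InnerProductSpace

namespace Literature.NumberTheory.ConnesConsani2021

open Literature.Analysis.OperatorTheory

variable {κ : ℝ → ℂ} {a b : ℝ}

/-! ## The truncated kernel `κ_S = 1_S κ`, `S = [a − b, b − a]` -/

/-- The kernel of (opkf) truncated to the window `S = [a − b, b − a]` over which (opkf) integrates:
`κ_S = 1_S κ`.  On `I × I` one has `y − x ∈ S`, so the truncation is invisible there; it makes the
kernel `κ_S(y − x)` globally bounded. [cite: ConnesConsani2021, Prop. 5.5 (ii) §5 p. 20] -/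
def windowKernel (a b : ℝ) (κ : ℝ → ℂ) : ℝ → ℂ := (Icc (a - b) (b - a)).indicator κ

/-- Unfolding `windowKernel`. [cite: ConnesConsani2021, Prop. 5.5 (ii) §5 p. 20] -/
theorem windowKernel_apply (a b : ℝ) (κ : ℝ → ℂ) (v : ℝ) :
    windowKernel a b κ v = (Icc (a - b) (b - a)).indicator κ v := rfl

/-- For `x, y ∈ I = [a, b]`, `y − x ∈ [a − b, b − a]`. [folklore] -/
private theorem sub_mem_window {x y : ℝ} (hx : x ∈ Icc a b) (hy : y ∈ Icc a b) :
    y - x ∈ Icc (a - b) (b - a) := by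
  simp only [mem_Icc] at hx hy ⊢
  constructor <;> linarith

/-- `κ_S(y − x) = κ(y − x)` for `x, y ∈ I`. [cite: ConnesConsani2021, Prop. 5.5 (ii) §5 p. 20] -/
theorem windowKernel_sub_of_mem {x y : ℝ} (hx : x ∈ Icc a b) (hy : y ∈ Icc a b) :
    windowKernel a b κ (y - x) = κ (y - x) := by
  rw [windowKernel, indicator_of_mem (sub_mem_window hx hy)]

/-- A continuous `κ` is bounded on the window: `‖κ_S v‖ ≤ C` for all `v`, some `C ≥ 0`. [folklore] -/
private theorem exists_bound_windowKernel (hκc : Continuous κ) :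
    ∃ C : ℝ, 0 ≤ C ∧ ∀ v, ‖windowKernel a b κ v‖ ≤ C := by
  obtain ⟨C, hC⟩ := (isCompact_Icc : IsCompact (Icc (a - b) (b - a))).exists_bound_of_continuousOn
    hκc.continuousOn
  refine ⟨max C 0, le_max_right _ _, fun v ↦ ?_⟩
  by_cases hv : v ∈ Icc (a - b) (b - a)
  · rw [windowKernel, indicator_of_mem hv]
    exact (hC v hv).trans (le_max_left _ _)
  · rw [windowKernel, indicator_of_notMem hv, norm_zero]
    exact le_max_right _ _

/-- `κ_S` is measurable for continuous `κ`. [folklore] -/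
private theorem measurable_windowKernel (hκc : Continuous κ) : Measurable (windowKernel a b κ) :=
  hκc.measurable.indicator measurableSet_Icc

/-- The two-variable kernel `K(y, x) = κ_S(y − x)` is strongly measurable. [folklore] -/
private theorem stronglyMeasurable_kernel (hκc : Continuous κ) :
    StronglyMeasurable (uncurry fun y x : ℝ ↦ windowKernel a b κ (y - x)) :=
  ((measurable_windowKernel hκc).comp (measurable_fst.sub measurable_snd)).stronglyMeasurable

/-! ## The Schwartz kernel of `windowOp κ`: one Fubini on `ℝ × ℝ`, one on `I × I` -/

/-- The zero extension of `ξ ∈ L²(I)` is integrable on `ℝ` (`L²(I) ⊆ L¹(I)`, `I` bounded). [folklore] -/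
private theorem integrable_zeroExt (ξ : Lp ℂ 2 (volume.restrict (Icc a b))) :
    Integrable (zeroExt ξ) := by
  rw [zeroExt, integrable_indicator_iff measurableSet_Icc]
  exact (Lp.memLp ξ).integrable one_le_two

/-- The double integrand `κ_S(v) ξ̃(x) conj η̃(x + v)` of the window form, in the variables `(v, x)`,
is integrable on `ℝ × ℝ` (shear `(v, x) ↦ (x, x + v)` of `ξ̃(x) conj η̃(y)`, times the bounded `κ_S(v)`).
[folklore] -/
private theorem integrable_windowIntegrand (hκc : Continuous κ)
    (ξ η : Lp ℂ 2 (volume.restrict (Icc a b))) :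
    Integrable (uncurry fun v x : ℝ ↦
      windowKernel a b κ v * (zeroExt ξ x * conj (zeroExt η (x + v)))) (volume.prod volume) := by
  obtain ⟨C, -, hC⟩ := exists_bound_windowKernel (a := a) (b := b) hκc
  -- `H(x, y) = ξ̃(x) conj η̃(y)` is integrable on `ℝ × ℝ`
  have hη : Integrable (fun y ↦ conj (zeroExt η y)) :=
    (integrable_zeroExt η).mono
      (continuous_conj.comp_aestronglyMeasurable (integrable_zeroExt η).aestronglyMeasurable)
      (Eventually.of_forall fun y ↦ by rw [RCLike.norm_conj])
  have hH : Integrable (fun z : ℝ × ℝ ↦ zeroExt ξ z.1 * conj (zeroExt η z.2))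
      (volume.prod volume) :=
    (integrable_zeroExt ξ).mul_prod hη
  -- compose with the measure-preserving shear `(v, x) ↦ (x, x + v)`
  have hT := measurePreserving_prod_add_swap (volume : Measure ℝ) (volume : Measure ℝ)
  have hHT : Integrable ((fun z : ℝ × ℝ ↦ zeroExt ξ z.1 * conj (zeroExt η z.2)) ∘
      fun z : ℝ × ℝ ↦ (z.2, z.2 + z.1)) (volume.prod volume) :=
    hT.integrable_comp_of_integrable hH
  -- multiply by the bounded measurable factor `κ_S(v)`
  have hm : AEStronglyMeasurable (fun z : ℝ × ℝ ↦ windowKernel a b κ z.1) (volume.prod volume) :=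
    ((measurable_windowKernel hκc).comp measurable_fst).aestronglyMeasurable
  refine (hHT.bdd_mul hm (Eventually.of_forall fun z ↦ hC z.1)).congr
    (Eventually.of_forall fun z ↦ ?_)
  simp only [uncurry, comp_apply]

/-- `∫ 1_I(x) f(x) dx = ∫_I f`: indicator bookkeeping for the zero extension. [folklore] -/
private theorem integral_zeroExt_mul (ξ : Lp ℂ 2 (volume.restrict (Icc a b))) (g : ℝ → ℂ) :
    ∫ x, zeroExt ξ x * g x = ∫ x in Icc a b, (ξ : ℝ → ℂ) x * g x := by
  rw [← integral_indicator measurableSet_Icc]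
  refine integral_congr_ae (Eventually.of_forall fun x ↦ ?_)
  by_cases hx : x ∈ Icc a b
  · simp only [zeroExt, indicator_of_mem hx]
  · simp only [zeroExt, indicator_of_notMem hx, zero_mul]

/-- `∫ conj(1_I η)(y) g(y) dy = ∫_I conj η · g`. [folklore] -/
private theorem integral_conj_zeroExt_mul (η : Lp ℂ 2 (volume.restrict (Icc a b))) (g : ℝ → ℂ) :
    ∫ y, conj (zeroExt η y) * g y = ∫ y in Icc a b, conj ((η : ℝ → ℂ) y) * g y := by
  rw [← integral_indicator measurableSet_Icc]
  refine integral_congr_ae (Eventually.of_forall fun y ↦ ?_)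
  by_cases hy : y ∈ Icc a b
  · simp only [zeroExt, indicator_of_mem hy]
  · simp only [zeroExt, indicator_of_notMem hy, map_zero, zero_mul]

/-- **The Schwartz kernel of the operator of (opkf)** (proof of Thm. 3.6, p. 13: "`K_I` … is given
by a Schwartz kernel `K̃_I(v, u)` … `Qδ(u/v)` if `u ≥ v`, `Qδ(v/u)` if `v ≥ u`"; Prop. 5.5 (ii) p. 21:
"the same as the argument developed at the end of the proof of Theorem 3.6"): for continuous `κ` and
`ξ, η ∈ L²(I)`,
`⟨η | windowOp κ ξ⟩ = ∫_I η̄(y) (∫_I κ_S(y − x) ξ(x) dx) dy`, i.e. `windowOp κ` is the integral operator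
with kernel `K(y, x) = κ(y − x)` on `I × I`.
[cite: ConnesConsani2021, Thm. 3.6 §3 p. 13 (proof); Prop. 5.5 (ii) §5 p. 21 (proof)] -/
theorem inner_windowOp_eq_integral_integral (hκ : IntegrableOn κ (Icc (a - b) (b - a)))
    (hκc : Continuous κ) (ξ η : Lp ℂ 2 (volume.restrict (Icc a b))) :
    ⟪η, windowOp a b hκ ξ⟫_ℂ
      = ∫ y in Icc a b, conj ((η : ℝ → ℂ) y) *
          ∫ x in Icc a b, windowKernel a b κ (y - x) * (ξ : ℝ → ℂ) x := by
  obtain ⟨C, -, hC⟩ := exists_bound_windowKernel (a := a) (b := b) hκc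
  rw [inner_windowOp]
  -- Step 1: the window form as a double integral over `ℝ × ℝ` in the variables `(v, x)`
  have h1 : windowForm a b κ ξ η
      = ∫ v, ∫ x, windowKernel a b κ v * (zeroExt ξ x * conj (zeroExt η (x + v))) := by
    rw [windowForm, kernelForm]
    have hS : ∫ v in Icc (a - b) (b - a), corrFun (zeroExt ξ) (zeroExt η) v * κ v
        = ∫ v in Icc (a - b) (b - a),
            ∫ x, windowKernel a b κ v * (zeroExt ξ x * conj (zeroExt η (x + v))) := by
      refine setIntegral_congr_fun measurableSet_Icc fun v hv ↦ ?_
      rw [windowKernel, indicator_of_mem hv, mul_comm (corrFun _ _ _) (κ v), corrFun,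
        ← integral_const_mul]
    rw [hS]
    refine setIntegral_eq_integral_of_forall_compl_eq_zero fun v hv ↦ ?_
    refine integral_eq_zero_of_ae (Eventually.of_forall fun x ↦ ?_)
    simp only [windowKernel, indicator_of_notMem hv, zero_mul, Pi.zero_apply]
  -- Step 2: Fubini on `ℝ × ℝ` and the substitution `y = x + v`
  have h2 : ∫ v, ∫ x, windowKernel a b κ v * (zeroExt ξ x * conj (zeroExt η (x + v)))
      = ∫ x, zeroExt ξ x * ∫ y, conj (zeroExt η y) * windowKernel a b κ (y - x) := by
    rw [integral_integral_swap (integrable_windowIntegrand hκc ξ η)]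
    refine integral_congr_ae (Eventually.of_forall fun x ↦ ?_)
    have e : ∀ v, windowKernel a b κ v * (zeroExt ξ x * conj (zeroExt η (x + v)))
        = zeroExt ξ x * (conj (zeroExt η (x + v)) * windowKernel a b κ (x + v - x)) := by
      intro v
      rw [add_sub_cancel_left]
      ring
    have hsub : ∫ v, conj (zeroExt η (x + v)) * windowKernel a b κ (x + v - x)
        = ∫ y, conj (zeroExt η y) * windowKernel a b κ (y - x) :=
      integral_add_left_eq_self (fun y ↦ conj (zeroExt η y) * windowKernel a b κ (y - x)) x
    show ∫ v, windowKernel a b κ v * (zeroExt ξ x * conj (zeroExt η (x + v)))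
      = zeroExt ξ x * ∫ y, conj (zeroExt η y) * windowKernel a b κ (y - x)
    rw [← hsub, ← integral_const_mul]
    exact integral_congr_ae (Eventually.of_forall e)
  -- Step 3: back to set integrals over `I`
  have h3 : ∫ x, zeroExt ξ x * ∫ y, conj (zeroExt η y) * windowKernel a b κ (y - x)
      = ∫ x in Icc a b, (ξ : ℝ → ℂ) x *
          ∫ y in Icc a b, conj ((η : ℝ → ℂ) y) * windowKernel a b κ (y - x) := by
    rw [integral_zeroExt_mul]
    refine integral_congr_ae (Eventually.of_forall fun x ↦ ?_)
    simp only [integral_conj_zeroExt_mul]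
  -- Step 4: Fubini on `I × I` (bounded kernel, `L²` vectors, finite measure)
  have h4 : ∫ y in Icc a b, conj ((η : ℝ → ℂ) y) *
        ∫ x in Icc a b, windowKernel a b κ (y - x) * (ξ : ℝ → ℂ) x
      = ∫ x in Icc a b, (ξ : ℝ → ℂ) x *
          ∫ y in Icc a b, conj ((η : ℝ → ℂ) y) * windowKernel a b κ (y - x) := by
    have e1 : ∀ y, conj ((η : ℝ → ℂ) y) * ∫ x in Icc a b, windowKernel a b κ (y - x) * (ξ : ℝ → ℂ) x
        = ∫ x in Icc a b, conj ((η : ℝ → ℂ) y) * (windowKernel a b κ (y - x) * (ξ : ℝ → ℂ) x) :=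
      fun y ↦ (integral_const_mul _ _).symm
    have e2 : ∀ x, (ξ : ℝ → ℂ) x * ∫ y in Icc a b, conj ((η : ℝ → ℂ) y) * windowKernel a b κ (y - x)
        = ∫ y in Icc a b, conj ((η : ℝ → ℂ) y) * (windowKernel a b κ (y - x) * (ξ : ℝ → ℂ) x) := by
      intro x
      rw [← integral_const_mul]
      refine integral_congr_ae (Eventually.of_forall fun y ↦ ?_)
      ring
    simp_rw [e1, e2]
    exact integral_integral_swap
      (integrable_conj_mul_kernel_mul_coeFn (𝕜 := ℂ) (μ := volume.restrict (Icc a b))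
        (K := fun y x : ℝ ↦ windowKernel a b κ (y - x)) (stronglyMeasurable_kernel hκc)
        (fun y x ↦ hC (y - x)) η ξ)
  rw [h1, h2, h3, h4]

/-- **`windowOp κ` is the integral operator with kernel `κ(y − x)`**: it coincides with any bounded
operator on `L²(I)` given a.e. by `(Aξ)(y) = ∫_I κ_S(y − x) ξ(x) dx` (such an `A` exists by the tree's
`exists_kernelOp_rclike`).
[cite: ConnesConsani2021, Thm. 3.6 §3 p. 13 (proof); Prop. 5.5 (ii) §5 p. 21 (proof)] -/
theorem windowOp_eq_of_ae_kernel (hκ : IntegrableOn κ (Icc (a - b) (b - a))) (hκc : Continuous κ)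
    {A : Lp ℂ 2 (volume.restrict (Icc a b)) →L[ℂ] Lp ℂ 2 (volume.restrict (Icc a b))}
    (hA : ∀ φ : Lp ℂ 2 (volume.restrict (Icc a b)),
      (A φ : ℝ → ℂ) =ᵐ[volume.restrict (Icc a b)]
        fun y ↦ ∫ x in Icc a b, windowKernel a b κ (y - x) * (φ : ℝ → ℂ) x) :
    windowOp a b hκ = A := by
  refine (windowOp_unique hκ fun ξ η ↦ ?_).symm
  exact (inner_eq_integral_of_ae_kernel hA η ξ).trans
    ((inner_windowOp_eq_integral_integral hκ hκc ξ η).symm.trans (inner_windowOp hκ ξ η))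

/-- **Connes–Consani 2021, Prop. 5.5 (ii) / Thm. 3.6 — compactness of the operator of (opkf)**:
"`𝐊_I` is the compact operator defined by (opkf)" (p. 20); "since the interval is bounded, the
function `K̃_I(v, u)` is square integrable and hence the operator `K_I` is of Hilbert–Schmidt class
and hence compact" (p. 13); "the proof of the compactness of the operator `𝐊_I` is the same … This
shows that `𝐊_I` is of Hilbert–Schmidt class" (p. 21).  For every continuous kernel `κ`, `windowOp κ`
on `L²([a, b])` is a compact operator (bounded kernel `κ(y − x)` on the bounded square `I × I`; the
tree's `isCompactOperator_of_ae_kernel`).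
[cite: ConnesConsani2021, Prop. 5.5 (ii) §5 pp. 20–21; Thm. 3.6 §3 p. 13] -/
theorem isCompactOperator_windowOp (hκ : IntegrableOn κ (Icc (a - b) (b - a)))
    (hκc : Continuous κ) : IsCompactOperator (windowOp a b hκ) := by
  obtain ⟨C, hC0, hC⟩ := exists_bound_windowKernel (a := a) (b := b) hκc
  obtain ⟨A, hA⟩ := exists_kernelOp_rclike (𝕜 := ℂ) (μ := volume.restrict (Icc a b))
    (K := fun y x : ℝ ↦ windowKernel a b κ (y - x)) (stronglyMeasurable_kernel hκc)
    (fun y x ↦ hC (y - x))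
  rw [windowOp_eq_of_ae_kernel hκ hκc hA]
  exact isCompactOperator_of_ae_kernel (fun y x ↦ hC (y - x)) hC0 hA

/-- **CC's `𝐊_I` is compact**: for `G ∈ C²`, the operator `windowOp ϖ_G` of Prop. 5.5 (ii)
(`ϖ_G = (opQ G)(|·|)/(2G′(0))`, CC: `G = ε∘exp`) is compact.
[cite: ConnesConsani2021, Prop. 5.5 (ii) §5 p. 20] -/
theorem isCompactOperator_windowOp_varpi {G : ℝ → ℂ} (hG : ContDiff ℝ 2 G) (a b : ℝ) :
    IsCompactOperator (windowOp a b (integrableOn_varpi hG a b)) :=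
  isCompactOperator_windowOp _ (continuous_varpi hG)

/-- **The `K_I` of Theorem 3.6's shape is compact**: for `G ∈ C²`, the operator `windowOp((opQ G)∘|·|)`
(`JumpFormula.evenFunctional_opQ_autocorr_eq_inner_of_deriv_eq_one`; CC: `G = δ∘exp`) is compact.
[cite: ConnesConsani2021, Thm. 3.6 §3 p. 13] -/
theorem isCompactOperator_windowOp_opQ_abs {G : ℝ → ℂ} (hG : ContDiff ℝ 2 G)
    (hκ : IntegrableOn (fun v ↦ opQ G |v|) (Icc (a - b) (b - a))) :
    IsCompactOperator (windowOp a b hκ) := by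
  have h1 : Continuous (deriv (deriv G)) := by
    have hG1 : ContDiff ℝ 1 (deriv G) := by
      rw [← one_add_one_eq_two] at hG
      exact hG.deriv'
    exact hG1.continuous_deriv le_rfl
  have hQ : Continuous (opQ G) := by
    show Continuous fun t ↦ -deriv (deriv G) t + (1 / 4 : ℂ) * G t
    exact h1.neg.add (continuous_const.mul hG.continuous)
  exact isCompactOperator_windowOp hκ (hQ.comp' continuous_abs)

end Literature.NumberTheory.ConnesConsani2021

end
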